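import Summits.QuantumAdvantage.AdviceFreeQNC0.CellParitySteps
import HarnessLib

/-!
# Cell qa-qnc0 (rung F-Q1, route RingFrame, crux α `RingToElim`): the CELL PARITY OBSTRUCTION —
# an even low-degree triple cannot track an even pair of arbitrary block triples on the 3 × 3 cells

The abstract heart of the blind-window theorem (`BlindWindowStrategies.lean`).  Data on a window
content `w = x ++ z` (`x ∈ {0,1}^L`, `z ∈ {0,1}^M`), with `i = |x| mod 3`, `j = |z| mod 3`,
`ρ = i + j`, `σ = 2i + j (mod 3)`:

* an EVEN triple `Φ_0, Φ_1, Φ_2` (`Φ_0 ⊕ Φ_1 ⊕ Φ_2 ≡ 0`) of Boolean functions of `𝔽₂`-degree `≤ D`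
  on `{0,1}^{L+M}` (in the application: the outside eliminator triple and the two end positions);
* ARBITRARY even triples `A_0, A_1, A_2` on `{0,1}^L` and `B_0, B_1, B_2` on `{0,1}^M` (in the
  application: parities of blind interior bets, read through the walk — of unbounded degree);
* an even triple of constants `m_0, m_1, m_2` (the junction position).

The CELL GAME is won at `w` iff `Φ_ρ(w) ⊕ m_σ ⊕ A_ρ(x) ⊕ B_σ(z) = 1`.

* `cellParity_obstruction` — **there are `η₁, c₁ > 0`, `n₀` such that for `L, M ≥ n₀` and
  `D ≤ c₁√L, c₁√M` every cell game is won on at most `(1 − η₁)·2^{L+M}` window contents.**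

Proof (the cell's, prover qn-prover-3, 2026-08-27).  Suppose the failure set is tiny.  Steps
(1)–(3) (`CellParitySteps.lean`): slices `α_ij ≈ A_ρ` on class `i`, `β_ij ≈ B_σ` on class `j`;
the degree-`D` identity `Φ_ρ = ¬(m_σ ⊕ α_ij ⊕ β_ij)` globalises (two-dimensional robust Hegedűs);
cells of one anti-diagonal give `α_ij ≈ α_0ρ ⊕ a_ij`, `β_ij ≈ β_0ρ ⊕ m_σ ⊕ m_ρ ⊕ a_ij`.  (4) At a point of the cell `(i, j)` avoiding
all exceptional sets (they have total measure `< 1/16`), evenness of `A` gives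
`⊕_r α_0r(x) = a_i0 ⊕ a_i1 ⊕ a_i2 =: K_A(i)`, evenness of `B` and `m` gives `⊕_r β_0r(z) = K_B(j)`,
evenness of `Φ` gives `⊕_r α_0r(x) ⊕ ⊕_r β_0r(z) = 1`; so `K_A(i) ⊕ K_B(j) = 1` for all nine cells
while `a_0j = 0` — and `⊕_i K_A(i) = ⊕_{ij} a_ij = ⊕_j K_B(j)` is then both `0` and `1`.

Not in print; it generalises the parity obstruction of the gap lemma (`CleanGapStrategies.lean`)
from constants to arbitrary blind bets.  WHAT THIS IS NOT: nothing here mentions walk strategies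
(see `BlindWindowStrategies.lean`); `η₁` is tiny; no separation.

## References

* S. Srinivasan, *A robust version of Hegedűs's lemma, with applications*, TheoretiCS 2 (2023),
  Lemma 3.1 [Srinivasan2023] (through `lowDeg_cell_extension`).
-/

noncomputable section

namespace Summit.QuantumAdvantage.AdviceFreeQNC0

open Finset
open Literature.Computability.MetaComplexity Literature.Computability.MetaComplexity.Smolensky

variable {L M D : ℕ}

/-! ### Pure Boolean bookkeeping -/

/-- Evenness of a triple read through three shifted identities (used for `A` and for `Φ`). -/
private theorem bool_E1 (A0 A1 A2 p0 p1 p2 a0 a1 a2 : Bool)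
    (hA : xor A0 (xor A1 A2) = false) (h0 : A0 = xor p0 a0) (h1 : A1 = xor p1 a1)
    (h2 : A2 = xor p2 a2) : xor p0 (xor p1 p2) = xor a0 (xor a1 a2) := by
  subst h0 h1 h2; revert hA; cases p0 <;> cases p1 <;> cases p2 <;> cases a0 <;> cases a1 <;>
    cases a2 <;> decide

/-- Evenness of `Φ` read through the three reference identities. -/
private theorem bool_E3 (F0 F1 F2 m0 m1 m2 p0 p1 p2 q0 q1 q2 : Bool)
    (hF : xor F0 (xor F1 F2) = false) (hm : xor m0 (xor m1 m2) = false)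
    (h0 : F0 = !(xor m0 (xor p0 q0))) (h1 : F1 = !(xor m1 (xor p1 q1)))
    (h2 : F2 = !(xor m2 (xor p2 q2))) :
    xor (xor p0 (xor p1 p2)) (xor q0 (xor q1 q2)) = true := by
  subst h0 h1 h2; revert hF hm
  cases m0 <;> cases m1 <;> cases m2 <;> cases p0 <;> cases p1 <;> cases p2 <;> cases q0 <;>
    cases q1 <;> cases q2 <;> decide

/-- The final parity contradiction on the nine constants `a_ij`. -/
private theorem bool_final (a : ℕ → ℕ → Bool) (h0 : ∀ j, j < 3 → a 0 j = false)
    (h : ∀ i j, i < 3 → j < 3 →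
      xor (xor (a i 0) (xor (a i 1) (a i 2))) (xor (a 0 j) (xor (a 1 j) (a 2 j))) = true) :
    False := by
  have hB : ∀ j, j < 3 → xor (a 0 j) (xor (a 1 j) (a 2 j)) = true := by
    intro j hj
    have := h 0 j (by norm_num) hj
    rw [h0 0 (by norm_num), h0 1 (by norm_num), h0 2 (by norm_num)] at this
    simpa using this
  have hA : ∀ i, i < 3 → xor (a i 0) (xor (a i 1) (a i 2)) = false := by
    intro i hi
    have := h i 0 hi (by norm_num)
    rw [hB 0 (by norm_num)] at this
    simpa using this
  have key : xor (xor (a 0 0) (xor (a 0 1) (a 0 2))) (xor (xor (a 1 0) (xor (a 1 1) (a 1 2)))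
      (xor (a 2 0) (xor (a 2 1) (a 2 2)))) =
      xor (xor (a 0 0) (xor (a 1 0) (a 2 0))) (xor (xor (a 0 1) (xor (a 1 1) (a 2 1)))
      (xor (a 0 2) (xor (a 1 2) (a 2 2)))) := by
    generalize a 0 0 = b00; generalize a 0 1 = b01; generalize a 0 2 = b02
    generalize a 1 0 = b10; generalize a 1 1 = b11; generalize a 1 2 = b12
    generalize a 2 0 = b20; generalize a 2 1 = b21; generalize a 2 2 = b22
    cases b00 <;> cases b01 <;> cases b02 <;> cases b10 <;> cases b11 <;> cases b12 <;>
      cases b20 <;> cases b21 <;> cases b22 <;> decide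
  rw [hA 0 (by norm_num), hA 1 (by norm_num), hA 2 (by norm_num), hB 0 (by norm_num),
    hB 1 (by norm_num), hB 2 (by norm_num)] at key
  exact absurd key (by decide)

/-! ### Step 4: the evenness identities at a good point -/

/-- Rotation of a triple `xor`. -/
private theorem xor_rot (a b c : Bool) : xor c (xor a b) = xor a (xor b c) := by
  cases a <;> cases b <;> cases c <;> decide

/-- (E1) At a good `x` of class `i`: `⊕_r α_0r(x) = a_i0 ⊕ a_i1 ⊕ a_i2`. -/
private theorem E1_of_good {i : ℕ} (hi : i < 3) {A : ℕ → (Fin L → Bool) → Bool}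
    {α : ℕ → ℕ → (Fin L → Bool) → Bool} {a : ℕ → ℕ → Bool} {x : Fin L → Bool}
    (hAe : xor (A 0 x) (xor (A 1 x) (A 2 x)) = false)
    (h : ∀ k, k < 3 → A ((i + k) % 3) x = xor (α 0 ((i + k) % 3) x) (a i k)) :
    xor (α 0 0 x) (xor (α 0 1 x) (α 0 2 x)) = xor (a i 0) (xor (a i 1) (a i 2)) := by
  have h0 := h 0 (by norm_num)
  have h1 := h 1 (by norm_num)
  have h2 := h 2 (by norm_num)
  interval_cases i
  · norm_num at h0 h1 h2
    exact bool_E1 _ _ _ _ _ _ _ _ _ hAe h0 h1 h2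
  · norm_num at h0 h1 h2
    rw [bool_E1 _ _ _ _ _ _ _ _ _ hAe h2 h0 h1, xor_rot]
  · norm_num at h0 h1 h2
    rw [bool_E1 _ _ _ _ _ _ _ _ _ hAe h1 h2 h0, ← xor_rot]

/-- (E2) At a good `z` of class `j`: `⊕_r β_0r(z) = a_0j ⊕ a_1j ⊕ a_2j`. -/
private theorem E2_of_good {j : ℕ} (hj : j < 3) {B : ℕ → (Fin M → Bool) → Bool}
    {β : ℕ → ℕ → (Fin M → Bool) → Bool} {m : ℕ → Bool} {a : ℕ → ℕ → Bool} {z : Fin M → Bool}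
    (hBe : xor (B 0 z) (xor (B 1 z) (B 2 z)) = false) (hme : xor (m 0) (xor (m 1) (m 2)) = false)
    (h : ∀ k, k < 3 → B ((2 * k + j) % 3) z =
      xor (xor (β 0 ((k + j) % 3) z) (xor (m ((2 * k + j) % 3)) (m ((k + j) % 3)))) (a k j)) :
    xor (β 0 0 z) (xor (β 0 1 z) (β 0 2 z)) = xor (a 0 j) (xor (a 1 j) (a 2 j)) := by
  have h0 := h 0 (by norm_num)
  have h1 := h 1 (by norm_num)
  have h2 := h 2 (by norm_num)
  interval_cases j
  all_goals
    simp only [Nat.reduceMul, Nat.reduceAdd, Nat.reduceMod] at h0 h1 h2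
    rw [h0, h1, h2] at hBe
    revert hBe hme
    generalize β 0 0 z = p0; generalize β 0 1 z = p1; generalize β 0 2 z = p2
    generalize m 0 = m0; generalize m 1 = m1; generalize m 2 = m2
    generalize a 0 _ = a0; generalize a 1 _ = a1; generalize a 2 _ = a2
    cases p0 <;> cases p1 <;> cases p2 <;> cases m0 <;> cases m1 <;> cases m2 <;> cases a0 <;>
      cases a1 <;> cases a2 <;> decide

/-- **A good point.**  If three exceptional sets — of left blocks, of right blocks, of window
contents — have densities `cX, cZ, cW` with `16(cX + cZ + cW) < 1`, every cell (`L, M ≥ 3`, so of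
density `≥ 1/16`) contains a point avoiding all three. -/
private theorem exists_good_point (hL : 3 ≤ L) (hM : 3 ≤ M) (bX : (Fin L → Bool) → Prop)
    (bZ : (Fin M → Bool) → Prop) (bW : (Fin (L + M) → Bool) → Prop) [DecidablePred bX]
    [DecidablePred bZ] [DecidablePred bW] {cX cZ cW : ℝ}
    (hX : ((univ.filter fun x : Fin L → Bool => bX x).card : ℝ) ≤ cX * (2 : ℝ) ^ L)
    (hZ : ((univ.filter fun z : Fin M → Bool => bZ z).card : ℝ) ≤ cZ * (2 : ℝ) ^ M)
    (hW : ((univ.filter fun w : Fin (L + M) → Bool => bW w).card : ℝ) ≤ cW * (2 : ℝ) ^ (L + M))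
    (hc : 16 * (cX + cZ + cW) < 1) (i j : ℕ) :
    ∃ w : Fin (L + M) → Bool, wt (fun i : Fin L => w (Fin.castAdd M i)) % 3 = i % 3 ∧
      wt (fun j : Fin M => w (Fin.natAdd L j)) % 3 = j % 3 ∧
      ¬ bX (fun i : Fin L => w (Fin.castAdd M i)) ∧ ¬ bZ (fun j : Fin M => w (Fin.natAdd L j)) ∧
      ¬ bW w := by
  classical
  by_contra hnone
  push Not at hnone
  have hcell := sixteen_mul_card_cell_ge hL hM i j
  -- the cell is covered by the three exceptional sets
  have hsub : ∀ w : Fin (L + M) → Bool,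
      (wt (fun i : Fin L => w (Fin.castAdd M i)) % 3 = i % 3 ∧
        wt (fun j : Fin M => w (Fin.natAdd L j)) % 3 = j % 3) →
      (bX (fun i : Fin L => w (Fin.castAdd M i)) ∨
        (bZ (fun j : Fin M => w (Fin.natAdd L j)) ∨ bW w)) := by
    intro w ⟨h1, h2⟩
    by_contra hcon
    push Not at hcon
    exact hcon.2.2 (hnone w h1 h2 hcon.1 hcon.2.1)
  have h1 := card_filter_mono_real _ _ hsub
  have h2 := card_filter_or_le_real (fun w : Fin (L + M) → Bool => bX (fun i : Fin L => w (Fin.castAdd M i)))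
    (fun w : Fin (L + M) → Bool => bZ (fun j : Fin M => w (Fin.natAdd L j)) ∨ bW w)
  have h3 := card_filter_or_le_real (fun w : Fin (L + M) → Bool => bZ (fun j : Fin M => w (Fin.natAdd L j)))
    (fun w : Fin (L + M) → Bool => bW w)
  have hX' : ((univ.filter fun w : Fin (L + M) → Bool =>
      bX (fun i : Fin L => w (Fin.castAdd M i))).card : ℝ) ≤ cX * (2 : ℝ) ^ (L + M) := by
    rw [card_filter_leftBlock (fun x : Fin L → Bool => bX x)]
    push_cast
    rw [pow_add]
    nlinarith [pow_pos (show (0 : ℝ) < 2 by norm_num) M]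
  have hZ' : ((univ.filter fun w : Fin (L + M) → Bool =>
      bZ (fun j : Fin M => w (Fin.natAdd L j))).card : ℝ) ≤ cZ * (2 : ℝ) ^ (L + M) := by
    rw [card_filter_rightBlock (fun z : Fin M → Bool => bZ z)]
    push_cast
    rw [pow_add]
    nlinarith [pow_pos (show (0 : ℝ) < 2 by norm_num) L]
  have hpos : (0 : ℝ) < (2 : ℝ) ^ (L + M) := by positivity
  nlinarith

/-! ### The theorem -/

/-- **THE CELL PARITY OBSTRUCTION.**  There are `η₁ > 0`, `c₁ > 0` and `n₀` such that for all
`L, M ≥ n₀`, all `D ≤ c₁√L`, `D ≤ c₁√M`, every even triple `Φ` of Boolean functions of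
`𝔽₂`-degree `≤ D` on `{0,1}^{L+M}`, all even triples `A` (on `{0,1}^L`), `B` (on `{0,1}^M`) of
ARBITRARY Boolean functions, every even triple of constants `m`, and every `W` given on
`w = x ++ z` by the cell formula `W = Φ_ρ(w) ⊕ m_σ ⊕ A_ρ(x) ⊕ B_σ(z)` (`ρ = |x| + |z|`,
`σ = 2|x| + |z|` mod `3`): `#{w : W w} ≤ (1 − η₁)·2^{L+M}`.  (Cell statement, prover qn-prover-3;
`η₁ = min(ε_T/9, 1/1000)` with `ε_T` from `lowDeg_cell_extension` at `γ = 1/500`.)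
[cite: Srinivasan2023, Lemma 3.1] -/
theorem cellParity_obstruction :
    ∃ η₁ : ℝ, 0 < η₁ ∧ ∃ c₁ : ℝ, 0 < c₁ ∧ ∃ n₀ : ℕ, ∀ L M : ℕ, n₀ ≤ L → n₀ ≤ M →
      ∀ D : ℕ, (D : ℝ) ≤ c₁ * Real.sqrt L → (D : ℝ) ≤ c₁ * Real.sqrt M →
      ∀ (Φ : ℕ → (Fin (L + M) → Bool) → Bool) (A : ℕ → (Fin L → Bool) → Bool)
        (B : ℕ → (Fin M → Bool) → Bool) (m : ℕ → Bool) (W : (Fin (L + M) → Bool) → Bool),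
        (∀ r, HasDeg (Φ r) D) →
        (∀ w, xor (Φ 0 w) (xor (Φ 1 w) (Φ 2 w)) = false) →
        (∀ x, xor (A 0 x) (xor (A 1 x) (A 2 x)) = false) →
        (∀ z, xor (B 0 z) (xor (B 1 z) (B 2 z)) = false) →
        xor (m 0) (xor (m 1) (m 2)) = false →
        (∀ (x : Fin L → Bool) (z : Fin M → Bool), W (Fin.append x z) =
          xor (Φ ((wt x + wt z) % 3) (Fin.append x z))
            (xor (m ((2 * wt x + wt z) % 3))
              (xor (A ((wt x + wt z) % 3) x) (B ((2 * wt x + wt z) % 3) z)))) →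
        ((univ.filter fun w : Fin (L + M) → Bool => W w = true).card : ℝ) ≤
          (1 - η₁) * (2 : ℝ) ^ (L + M) := by
  obtain ⟨εT, hεT, c₁, hc₁, n₁, hT⟩ := lowDeg_cell_extension (1 / 500) (by norm_num)
  refine ⟨min (εT / 9) (1 / 1000), lt_min (by positivity) (by norm_num), c₁, hc₁, max n₁ 3, ?_⟩
  intro L M hL hM D hDL hDM Φ A B m W hΦ hΦe hAe hBe hme hW
  set ε₀ : ℝ := min (εT / 9) (1 / 1000) with hε₀
  have hε₀T : 9 * ε₀ ≤ εT := by
    have : ε₀ ≤ εT / 9 := min_le_left _ _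
    linarith
  have hε₀s : ε₀ ≤ 1 / 1000 := min_le_right _ _
  have hε₀p : 0 < ε₀ := lt_min (by positivity) (by norm_num)
  have hL3 : 3 ≤ L := le_trans (le_max_right _ _) hL
  have hM3 : 3 ≤ M := le_trans (le_max_right _ _) hM
  have hn₁L : n₁ ≤ L := le_trans (le_max_left _ _) hL
  have hn₁M : n₁ ≤ M := le_trans (le_max_left _ _) hM
  set N : ℝ := (2 : ℝ) ^ (L + M) with hN
  have hNpos : 0 < N := by positivity
  -- wins and failures
  have hsplit : ((univ.filter fun w : Fin (L + M) → Bool => W w = true).card : ℝ) +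
      ((univ.filter fun w : Fin (L + M) → Bool => W w = false).card : ℝ) = N := by
    have h := Finset.card_filter_add_card_filter_not (s := (univ : Finset (Fin (L + M) → Bool)))
      (fun w => W w = true)
    have h2 : (univ.filter fun w : Fin (L + M) → Bool => ¬ W w = true) =
        univ.filter fun w : Fin (L + M) → Bool => W w = false :=
      Finset.filter_congr fun w _ => by simp
    rw [h2, Finset.card_univ, Fintype.card_fun, Fintype.card_bool, Fintype.card_fin] at h
    rw [hN]; exact_mod_cast h
  by_contra hcon
  have hfail : ((univ.filter fun w : Fin (L + M) → Bool => W w = false).card : ℝ) ≤ ε₀ * N := by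
    push Not at hcon
    linarith
  -- Step 1
  choose α hαdeg hαA using fun i j => cellParity_row_approx (D := D) hW hΦ hM3 hfail i j
  choose β hβdeg hβB using fun i j => cellParity_col_approx (D := D) hW hΦ hL3 hfail i j
  -- Step 2
  have hT' := hT L M hn₁L hn₁M D hDL hDM
  have hG : ∀ i j : ℕ, ((univ.filter fun w : Fin (L + M) → Bool =>
      Φ ((i + j) % 3) w ≠ !(xor (m ((2 * i + j) % 3))
        (xor (α i j (fun i : Fin L => w (Fin.castAdd M i)))
          (β i j (fun j : Fin M => w (Fin.natAdd L j)))))).card : ℝ) ≤ 1 / 500 * N :=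
    fun i j => cellParity_globalise (D := D) hW hΦ hε₀T hT' hfail i j (hαdeg i j) (hβdeg i j) (hαA i j) (hβB i j)
  -- Step 3
  have hGr : ∀ i j : ℕ, ((univ.filter fun w : Fin (L + M) → Bool =>
      Φ ((i + j) % 3) w ≠ !(xor (m ((i + j) % 3))
        (xor (α 0 ((i + j) % 3) (fun i : Fin L => w (Fin.castAdd M i)))
          (β 0 ((i + j) % 3) (fun j : Fin M => w (Fin.natAdd L j)))))).card : ℝ) ≤ 1 / 500 * N := by
    intro i j
    have h := hG 0 ((i + j) % 3)
    have e1 : (0 + (i + j) % 3) % 3 = (i + j) % 3 := by omega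
    rw [e1] at h
    exact h
  choose a haX haZ using fun i j => cellParity_antidiag_const (L := L) (M := M) (Φ := Φ) (m := m)
    (γ := 1 / 500) (by norm_num) i j (hG i j) (hGr i j)
  -- Step 4: a good point of each cell and the evenness identities there
  have h16 : 16 * ((12 * ε₀ + 6 / 500) + (12 * ε₀ + 6 / 500) + 3 / 500) < 1 := by nlinarith
  have main : ∀ i j : ℕ, i < 3 → j < 3 → (∀ k, k < 3 → a 0 k = false) ∧
      xor (xor (a i 0) (xor (a i 1) (a i 2))) (xor (a 0 j) (xor (a 1 j) (a 2 j))) = true := by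
    intro i j hi hj
    -- the three exceptional sets and their densities
    have hbX : ((univ.filter fun x : Fin L → Bool =>
        ((wt x % 3 = i % 3 ∧ A ((i + 0) % 3) x ≠ α i 0 x) ∨
          xor (α i 0 x) (α 0 ((i + 0) % 3) x) ≠ a i 0) ∨
        ((wt x % 3 = i % 3 ∧ A ((i + 1) % 3) x ≠ α i 1 x) ∨
          xor (α i 1 x) (α 0 ((i + 1) % 3) x) ≠ a i 1) ∨
        ((wt x % 3 = i % 3 ∧ A ((i + 2) % 3) x ≠ α i 2 x) ∨
          xor (α i 2 x) (α 0 ((i + 2) % 3) x) ≠ a i 2)).card : ℝ) ≤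
        (12 * ε₀ + 6 / 500) * (2 : ℝ) ^ L := by
      refine le_trans (card_filter_or3_le_real (fun k x =>
        (wt x % 3 = i % 3 ∧ A ((i + k) % 3) x ≠ α i k x) ∨
          xor (α i k x) (α 0 ((i + k) % 3) x) ≠ a i k)) ?_
      have hk : ∀ k, ((univ.filter fun x : Fin L → Bool =>
          (wt x % 3 = i % 3 ∧ A ((i + k) % 3) x ≠ α i k x) ∨
            xor (α i k x) (α 0 ((i + k) % 3) x) ≠ a i k).card : ℝ) ≤
          4 * ε₀ * (2 : ℝ) ^ L + 2 * (1 / 500) * (2 : ℝ) ^ L := fun k =>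
        le_trans (card_filter_or_le_real _ _) (add_le_add (hαA i k) (haX i k))
      have h0 := hk 0; have h1 := hk 1; have h2 := hk 2
      linarith
    have hbZ : ((univ.filter fun z : Fin M → Bool =>
        ((wt z % 3 = j % 3 ∧ B ((2 * 0 + j) % 3) z ≠ β 0 j z) ∨
          xor (xor (β 0 j z) (β 0 ((0 + j) % 3) z)) (xor (m ((2 * 0 + j) % 3)) (m ((0 + j) % 3))) ≠
            a 0 j) ∨
        ((wt z % 3 = j % 3 ∧ B ((2 * 1 + j) % 3) z ≠ β 1 j z) ∨
          xor (xor (β 1 j z) (β 0 ((1 + j) % 3) z)) (xor (m ((2 * 1 + j) % 3)) (m ((1 + j) % 3))) ≠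
            a 1 j) ∨
        ((wt z % 3 = j % 3 ∧ B ((2 * 2 + j) % 3) z ≠ β 2 j z) ∨
          xor (xor (β 2 j z) (β 0 ((2 + j) % 3) z)) (xor (m ((2 * 2 + j) % 3)) (m ((2 + j) % 3))) ≠
            a 2 j)).card : ℝ) ≤ (12 * ε₀ + 6 / 500) * (2 : ℝ) ^ M := by
      refine le_trans (card_filter_or3_le_real (fun k z =>
        (wt z % 3 = j % 3 ∧ B ((2 * k + j) % 3) z ≠ β k j z) ∨
          xor (xor (β k j z) (β 0 ((k + j) % 3) z)) (xor (m ((2 * k + j) % 3)) (m ((k + j) % 3))) ≠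
            a k j)) ?_
      have hk : ∀ k, ((univ.filter fun z : Fin M → Bool =>
          (wt z % 3 = j % 3 ∧ B ((2 * k + j) % 3) z ≠ β k j z) ∨
            xor (xor (β k j z) (β 0 ((k + j) % 3) z)) (xor (m ((2 * k + j) % 3)) (m ((k + j) % 3))) ≠
              a k j).card : ℝ) ≤
          4 * ε₀ * (2 : ℝ) ^ M + 2 * (1 / 500) * (2 : ℝ) ^ M := fun k =>
        le_trans (card_filter_or_le_real _ _) (add_le_add (hβB k j) (haZ k j))
      have h0 := hk 0; have h1 := hk 1; have h2 := hk 2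
      linarith
    have hbW : ((univ.filter fun w : Fin (L + M) → Bool =>
        (Φ ((0 + 0) % 3) w ≠ !(xor (m ((2 * 0 + 0) % 3))
          (xor (α 0 0 (fun i : Fin L => w (Fin.castAdd M i)))
            (β 0 0 (fun j : Fin M => w (Fin.natAdd L j)))))) ∨
        (Φ ((0 + 1) % 3) w ≠ !(xor (m ((2 * 0 + 1) % 3))
          (xor (α 0 1 (fun i : Fin L => w (Fin.castAdd M i)))
            (β 0 1 (fun j : Fin M => w (Fin.natAdd L j)))))) ∨
        (Φ ((0 + 2) % 3) w ≠ !(xor (m ((2 * 0 + 2) % 3))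
          (xor (α 0 2 (fun i : Fin L => w (Fin.castAdd M i)))
            (β 0 2 (fun j : Fin M => w (Fin.natAdd L j))))))).card : ℝ) ≤ 3 / 500 * (2 : ℝ) ^ (L + M) := by
      refine le_trans (card_filter_or3_le_real (fun k (w : Fin (L + M) → Bool) =>
        Φ ((0 + k) % 3) w ≠ !(xor (m ((2 * 0 + k) % 3))
          (xor (α 0 k (fun i : Fin L => w (Fin.castAdd M i)))
            (β 0 k (fun j : Fin M => w (Fin.natAdd L j))))))) ?_
      have h0 := hG 0 0; have h1 := hG 0 1; have h2 := hG 0 2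
      rw [hN] at h0 h1 h2
      linarith
    -- a good point
    obtain ⟨w, hxi, hzj, hgX, hgZ, hgW⟩ := exists_good_point hL3 hM3 _ _ _ hbX hbZ hbW h16 i j
    simp only [not_and, not_or, not_not] at hgX hgZ hgW
    obtain ⟨⟨hgX0, hgX0'⟩, ⟨hgX1, hgX1'⟩, ⟨hgX2, hgX2'⟩⟩ := hgX
    obtain ⟨⟨hgZ0, hgZ0'⟩, ⟨hgZ1, hgZ1'⟩, ⟨hgZ2, hgZ2'⟩⟩ := hgZ
    obtain ⟨hgW0, hgW1, hgW2⟩ := hgW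
    -- the identities at the good point
    have hA_id : ∀ k, k < 3 → A ((i + k) % 3) (fun i : Fin L => w (Fin.castAdd M i)) =
        xor (α 0 ((i + k) % 3) (fun i : Fin L => w (Fin.castAdd M i))) (a i k) := by
      have key : ∀ (k : ℕ) (Ak αk αr : Bool) (ak : Bool),
          (wt (fun i : Fin L => w (Fin.castAdd M i)) % 3 = i % 3 → Ak = αk) →
          xor αk αr = ak → Ak = xor αr ak := by
        intro k Ak αk αr ak h1 h2
        have e1 : Ak = αk := h1 hxi
        subst e1; rw [← h2]; cases Ak <;> cases αr <;> rfl
      intro k hk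
      interval_cases k
      · exact key 0 _ _ _ _ hgX0 hgX0'
      · exact key 1 _ _ _ _ hgX1 hgX1'
      · exact key 2 _ _ _ _ hgX2 hgX2'
    have hB_id : ∀ k, k < 3 → B ((2 * k + j) % 3) (fun j : Fin M => w (Fin.natAdd L j)) =
        xor (xor (β 0 ((k + j) % 3) (fun j : Fin M => w (Fin.natAdd L j)))
          (xor (m ((2 * k + j) % 3)) (m ((k + j) % 3)))) (a k j) := by
      have key : ∀ (Bk βk βr m1 m2 ak : Bool),
          (wt (fun j : Fin M => w (Fin.natAdd L j)) % 3 = j % 3 → Bk = βk) →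
          xor (xor βk βr) (xor m1 m2) = ak → Bk = xor (xor βr (xor m1 m2)) ak := by
        intro Bk βk βr m1 m2 ak h1 h2
        have e1 : Bk = βk := h1 hzj
        subst e1; rw [← h2]; cases Bk <;> cases βr <;> cases m1 <;> cases m2 <;> rfl
      intro k hk
      interval_cases k
      · exact key _ _ _ _ _ _ hgZ0 hgZ0'
      · exact key _ _ _ _ _ _ hgZ1 hgZ1'
      · exact key _ _ _ _ _ _ hgZ2 hgZ2'
    have hΦ_id : ∀ k, k < 3 → Φ k w = !(xor (m k)
        (xor (α 0 k (fun i : Fin L => w (Fin.castAdd M i))) (β 0 k (fun j : Fin M => w (Fin.natAdd L j))))) := by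
      intro k hk
      interval_cases k
      · simpa using hgW0
      · simpa using hgW1
      · simpa using hgW2
    -- (E1), (E2), (E3)
    have hE1 := E1_of_good hi (hAe _) hA_id
    have hE2 := E2_of_good hj (hBe _) hme hB_id
    have hE3 := bool_E3 _ _ _ _ _ _ _ _ _ _ _ _ (hΦe w) hme (hΦ_id 0 (by norm_num))
      (hΦ_id 1 (by norm_num)) (hΦ_id 2 (by norm_num))
    rw [hE1, hE2] at hE3
    refine ⟨fun k hk => ?_, hE3⟩
    -- `a 0 k = false`: otherwise EVERY left block would be exceptional for the cell `(0, k)`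
    by_contra hak
    have hak' : a 0 k = true := by
      revert hak; cases a 0 k <;> simp
    have hall : ((univ.filter fun x : Fin L → Bool =>
        xor (α 0 k x) (α 0 ((0 + k) % 3) x) ≠ a 0 k).card : ℝ) = (2 : ℝ) ^ L := by
      have e1 : (0 + k) % 3 = k := by omega
      have : (univ.filter fun x : Fin L → Bool => xor (α 0 k x) (α 0 ((0 + k) % 3) x) ≠ a 0 k) =
          univ := by
        rw [Finset.filter_eq_self]
        intro y _
        rw [e1, Bool.xor_self, hak']
        decide
      rw [this]; simp
    have h := haX 0 k
    rw [hall] at h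
    have : (0 : ℝ) < (2 : ℝ) ^ L := by positivity
    nlinarith
  have h00 := (main 0 0 (by norm_num) (by norm_num)).1
  exact bool_final a h00 (fun i j hi hj => (main i j hi hj).2)

end Summit.QuantumAdvantage.AdviceFreeQNC0
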